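import Mathlib
import HarnessLib
import Summits.HubbardSuperconductivity.HubbardSuperconductivity.Theses.LiebTwin
import Literature.MathematicalPhysics.QuantumLattice.RegionalNumberCharge
import Literature.MathematicalPhysics.QuantumLattice.PairingChannelIdentities
import Literature.MathematicalPhysics.QuantumLattice.HubbardModelProofs
import Literature.MathematicalPhysics.QuantumLattice.HubbardHubbardModelEtaODLROProofs

/-!
# Crux `NoOnsiteODLRO` (stmt-HubbardSuperconductivity-0933) — sublattice-number charges and the `f`-sum rule

CAR bookkeeping for the pseudospin ceiling on the on-site pair structure factor
(`LiebTwinNoOnsiteODLROPseudospinCeiling.lean`; crux-strategist census by-product B3,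
`Cruxes/NoOnsiteODLRO/STRATEGY-CENSUS.md`, Transfer T2). For a finite set of sites `Λ`, a sign `ε : Λ → ℤˣ`
and the particle number `N_A = diag(s ↦ #(s ∩ orbs A))` of the sublattice `A = {ε = 1}` (written out, no
definition; toolkit `RegionalNumberCharge`):

* charges: `c_{zσ}` has charge `-[z ∈ R]`, the on-site pair annihilator `c_{x↓}c_{x↑}` charge `-2[x ∈ R]`
  under `N_{orbs R}`; hence **`N_A η_ε - η_ε N_A = -(η_ε + η₁)`** (`numberDiag_sublattice_comm_etaLower`),
  `η₁ = etaLower 1` — the one-sublattice component of Zhang's pseudospin-vector relation `[ρ_Q, η] = -2η₁`;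
* **the `f`-sum operator identity** `N_A (H N_A - N_A H) - (H N_A - N_A H) N_A = -H(t,0)` for the Hubbard
  Hamiltonian on any graph carrying a bipartite sign (`doubleComm_numberDiag_sublattice_hamiltonian`;
  every hopping term crosses the sublattice boundary with charge `±1`, the interaction is neutral), and its
  torus form (`stub_sublatticeFSumIdentity`, even side);
* **the `f`-sum rule in an eigenvector**: `2(Re⟨Nψ, H Nψ⟩ - E‖Nψ‖²) = -Re⟨ψ, Tψ⟩` whenever `Hψ = Eψ`,
  `H`, `N` Hermitian and the double commutator is `-T` (`two_mul_re_form_eq_neg_re`, Koma–Tasaki).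

Sources: S. C. Zhang, PRL 65 (1990) 120; C. N. Yang, S. C. Zhang, Mod. Phys. Lett. B 4 (1990) 759;
C. N. Yang, PRL 63 (1989) 2144; T. Koma, H. Tasaki, J. Stat. Phys. 76 (1994) 745 (proof of Thm 2.2);
O. Bratteli, D. W. Robinson, *Operator Algebras and QSM II* §5.2.2. All statements are folklore CAR algebra;
no definition is introduced.
-/

noncomputable section

-- the mandated namespace `Summit.<Summit>.<Problem>.Theorems` repeats `HubbardSuperconductivity`
-- (single-problem summit, D-0017), which the `dupNamespace` linter flags on every declaration
set_option linter.dupNamespace false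

namespace Summit.HubbardSuperconductivity.HubbardSuperconductivity.Theorems.NoOnsiteODLRO.Pseudospin

open Matrix Finset
open Literature.Probability.LatticeModels Literature.MathematicalPhysics.QuantumLattice
open scoped ComplexOrder

/-! ### Charges of the pair operators under a regional particle number -/

section Charges

variable {Λ : Type*} [LinearOrder Λ] [DecidableEq Λ] [Fintype Λ]

/-- Charge of `c_{zσ}` under the regional number `N_{orbs R}`: `-[z ∈ R]`. Bratteli–Robinson II §5.2.2.
[folklore] -/
theorem numberDiag_orbs_comm_annihilation (R : Finset Λ) (z : Λ) (σ : Fin 2) :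
    diagonal (fun s : Finset (Orb Λ) => (((s ∩ orbs R).card : ℕ) : ℂ)) * annihilation (orb z σ) -
        annihilation (orb z σ) * diagonal (fun s : Finset (Orb Λ) => (((s ∩ orbs R).card : ℕ) : ℂ)) =
      (-(((if z ∈ R then 1 else 0 : ℕ) : ℂ))) • annihilation (orb z σ) := by
  rw [numberDiag_comm_annihilation (ι := Orb Λ)]
  congr 1
  by_cases hz : z ∈ R <;> simp [hz]

/-- Charge of the on-site pair annihilator `c_{x↓} c_{x↑}` under `N_{orbs R}`: `-2[x ∈ R]`.
Bratteli–Robinson II §5.2.2. [folklore] -/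
theorem numberDiag_orbs_comm_pairAnnihilation (R : Finset Λ) (x : Λ) :
    diagonal (fun s : Finset (Orb Λ) => (((s ∩ orbs R).card : ℕ) : ℂ)) *
          (annihilation (orb x 1) * annihilation (orb x 0)) -
        annihilation (orb x 1) * annihilation (orb x 0) *
          diagonal (fun s : Finset (Orb Λ) => (((s ∩ orbs R).card : ℕ) : ℂ)) =
      (-(2 * (((if x ∈ R then 1 else 0 : ℕ) : ℂ)))) • (annihilation (orb x 1) * annihilation (orb x 0)) := by
  rw [comm_mul_of_comm_eq_smul (numberDiag_orbs_comm_annihilation R x 1)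
    (numberDiag_orbs_comm_annihilation R x 0)]
  congr 1
  ring

/-- `[N_{orbs R}, η_ε] = Σ_x (-2[x ∈ R] ε_x) c_{x↓} c_{x↑}`. Yang, PRL 63 (1989) 2144, eq. (4). [folklore] -/
theorem numberDiag_orbs_comm_etaLower (R : Finset Λ) (ε : Λ → ℤˣ) :
    diagonal (fun s : Finset (Orb Λ) => (((s ∩ orbs R).card : ℕ) : ℂ)) * etaLower ε -
        etaLower ε * diagonal (fun s : Finset (Orb Λ) => (((s ∩ orbs R).card : ℕ) : ℂ)) =
      ∑ x : Λ, (((ε x : ℤ) : ℂ) * -(2 * (((if x ∈ R then 1 else 0 : ℕ) : ℂ)))) •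
        (annihilation (orb x 1) * annihilation (orb x 0)) := by
  rw [EtaPairingODLRO.etaLower_eq_sum' ε, Finset.mul_sum, Finset.sum_mul, ← Finset.sum_sub_distrib]
  refine Finset.sum_congr rfl fun x _ => ?_
  rw [Matrix.mul_smul, Matrix.smul_mul, ← smul_sub, numberDiag_orbs_comm_pairAnnihilation, smul_smul]

/-- **The sublattice number and Yang's `η`.** For a sign `ε : Λ → ℤˣ`, the particle number `N_A` of the
sublattice `A = {ε = 1}` satisfies `N_A η_ε - η_ε N_A = -(η_ε + η₁)`, `η₁ = etaLower 1` (the pair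
annihilator at `x` has charge `-2[x ∈ A] = -(1 + ε_x)`). This is the component of Zhang's pseudospin-vector
relation `[ρ_Q, η] = -2η₁` that survives with one sublattice. Zhang, PRL 65 (1990) 120. [folklore] -/
theorem numberDiag_sublattice_comm_etaLower (ε : Λ → ℤˣ) :
    diagonal (fun s : Finset (Orb Λ) =>
          (((s ∩ orbs (Finset.univ.filter fun x => ε x = 1)).card : ℕ) : ℂ)) * etaLower ε -
        etaLower ε * diagonal (fun s : Finset (Orb Λ) =>
          (((s ∩ orbs (Finset.univ.filter fun x => ε x = 1)).card : ℕ) : ℂ)) =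
      -(etaLower ε + etaLower (fun _ => 1)) := by
  rw [numberDiag_orbs_comm_etaLower, EtaPairingODLRO.etaLower_eq_sum' ε,
    EtaPairingODLRO.etaLower_eq_sum' (fun _ : Λ => (1 : ℤˣ)), ← Finset.sum_add_distrib,
    ← Finset.sum_neg_distrib]
  refine Finset.sum_congr rfl fun x _ => ?_
  rw [← add_smul, ← neg_smul]
  congr 1
  rcases Int.units_eq_one_or (ε x) with h | h
  · have hx : x ∈ Finset.univ.filter fun y => ε y = 1 := Finset.mem_filter.2 ⟨Finset.mem_univ _, h⟩
    rw [if_pos hx, h]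
    push_cast
    ring
  · have hx : x ∉ Finset.univ.filter fun y => ε y = 1 := by
      rw [Finset.mem_filter, h]
      rintro ⟨-, h1⟩
      exact absurd h1 (by decide)
    rw [if_neg hx, h]
    push_cast
    ring

omit [LinearOrder Λ] in
/-- Across an edge of a bipartite sign the sublattice indicator jumps by `±1`:
`([x ∈ A] - [y ∈ A])² = 1` for `ε x = -ε y`, `A = {ε = 1}`. [folklore] -/
theorem sublattice_indicator_sub_sq {ε : Λ → ℤˣ} {x y : Λ} (h : ε x = -ε y) :
    ((((if x ∈ Finset.univ.filter (fun z => ε z = 1) then 1 else 0 : ℕ) : ℂ)) -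
        (((if y ∈ Finset.univ.filter (fun z => ε z = 1) then 1 else 0 : ℕ) : ℂ))) ^ 2 = 1 := by
  rcases Int.units_eq_one_or (ε y) with hy | hy
  · have hx : ε x = -1 := by rw [h, hy]
    have hxA : x ∉ Finset.univ.filter fun z => ε z = 1 := by
      simp [Finset.mem_filter, Int.units_ne_iff_eq_neg.2 hx]
    have hyA : y ∈ Finset.univ.filter fun z => ε z = 1 := by simp [hy]
    rw [if_neg hxA, if_pos hyA]
    norm_num
  · have hx : ε x = 1 := by rw [h, hy, neg_neg]
    have hxA : x ∈ Finset.univ.filter fun z => ε z = 1 := by simp [hx]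
    have hyA : y ∉ Finset.univ.filter fun z => ε z = 1 := by
      simp [Finset.mem_filter, Int.units_ne_iff_eq_neg.2 hy]
    rw [if_pos hxA, if_neg hyA]
    norm_num

variable (G : SimpleGraph Λ) [DecidableRel G.Adj]

/-- **The `f`-sum operator identity for the sublattice number.** On a finite graph `G` with a bipartite sign
`ε` (`ε x = -ε y` on edges) and `A = {ε = 1}`, the double commutator of the Hubbard Hamiltonian with the
sublattice number is minus the hopping operator:
`N_A (H N_A - N_A H) - (H N_A - N_A H) N_A = -H(t, 0)` (every hopping term crosses the sublattice boundary,
charge `±1`; the interaction is diagonal). The pseudospin-vector partner of Yang's `[H, η†] = Uη†`.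
Zhang, PRL 65 (1990) 120; Koma–Tasaki, J. Stat. Phys. 76 (1994) 745. [folklore] -/
theorem doubleComm_numberDiag_sublattice_hamiltonian (ε : Λ → ℤˣ) (hε : ∀ x y, G.Adj x y → ε x = -ε y)
    (t U : ℝ) :
    diagonal (fun s : Finset (Orb Λ) =>
          (((s ∩ orbs (Finset.univ.filter fun x => ε x = 1)).card : ℕ) : ℂ)) *
          (hamiltonian G t U * diagonal (fun s : Finset (Orb Λ) =>
              (((s ∩ orbs (Finset.univ.filter fun x => ε x = 1)).card : ℕ) : ℂ)) -
            diagonal (fun s : Finset (Orb Λ) =>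
              (((s ∩ orbs (Finset.univ.filter fun x => ε x = 1)).card : ℕ) : ℂ)) * hamiltonian G t U) -
        (hamiltonian G t U * diagonal (fun s : Finset (Orb Λ) =>
              (((s ∩ orbs (Finset.univ.filter fun x => ε x = 1)).card : ℕ) : ℂ)) -
            diagonal (fun s : Finset (Orb Λ) =>
              (((s ∩ orbs (Finset.univ.filter fun x => ε x = 1)).card : ℕ) : ℂ)) * hamiltonian G t U) *
          diagonal (fun s : Finset (Orb Λ) =>
            (((s ∩ orbs (Finset.univ.filter fun x => ε x = 1)).card : ℕ) : ℂ)) =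
      -hamiltonian G t 0 := by
  set A : Finset Λ := Finset.univ.filter fun x => ε x = 1 with hAdef
  set N : Matrix (Finset (Orb Λ)) (Finset (Orb Λ)) ℂ :=
    diagonal (fun s : Finset (Orb Λ) => (((s ∩ orbs A).card : ℕ) : ℂ)) with hNdef
  -- hopping terms: charge `±1`
  have hhop : ∀ (x y : Λ) (σ : Fin 2),
      N * ((if G.Adj x y then creation (orb x σ) * annihilation (orb y σ) else 0) * N -
          N * (if G.Adj x y then creation (orb x σ) * annihilation (orb y σ) else 0)) -
        ((if G.Adj x y then creation (orb x σ) * annihilation (orb y σ) else 0) * N -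
          N * (if G.Adj x y then creation (orb x σ) * annihilation (orb y σ) else 0)) * N =
      -(if G.Adj x y then creation (orb x σ) * annihilation (orb y σ) else 0) := by
    intro x y σ
    by_cases hxy : G.Adj x y
    · simp only [if_pos hxy]
      rw [doubleComm_of_comm_eq_smul (numberDiag_comm_creation_mul_annihilation A x y σ σ), hAdef,
        sublattice_indicator_sub_sq (hε x y hxy), one_smul]
    · simp only [if_neg hxy, Matrix.mul_zero, Matrix.zero_mul, sub_self, neg_zero]
  -- interaction terms: charge `0`
  have hint : ∀ x : Λ,
      N * (numberOp x 0 * numberOp x 1 * N - N * (numberOp x 0 * numberOp x 1)) -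
        (numberOp x 0 * numberOp x 1 * N - N * (numberOp x 0 * numberOp x 1)) * N = 0 := by
    intro x
    apply doubleComm_of_comm_eq_zero
    have h0 := numberDiag_comm_creation_mul_annihilation A x x (0 : Fin 2) 0
    have h1 := numberDiag_comm_creation_mul_annihilation A x x (1 : Fin 2) 1
    rw [sub_self] at h0 h1
    have h := comm_mul_of_comm_eq_smul h0 h1
    rw [add_zero, zero_smul] at h
    exact h
  -- assemble
  unfold hamiltonian
  rw [doubleComm_add, doubleComm_smul, doubleComm_smul]
  simp only [doubleComm_sum, hhop, hint, Finset.sum_neg_distrib, Finset.sum_const_zero, smul_zero,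
    add_zero, smul_neg, neg_smul, neg_neg, Complex.ofReal_zero, zero_smul]

end Charges

/-! ### The `f`-sum rule in a sector ground state -/

section FSum

variable {n : Type} [Fintype n] [DecidableEq n]

/-- **Double-commutator (`f`-sum) identity in an eigenvector.** If `H`, `N` are Hermitian, `H ψ = E ψ` with
`E` real, and `N (H N - N H) - (H N - N H) N = -T`, then
`2 (Re⟨Nψ, H Nψ⟩ - E ‖Nψ‖²) = -Re⟨ψ, T ψ⟩` (Koma–Tasaki's identity `⟨[N,[K,N]]⟩ = 2⟨Nψ, K Nψ⟩` for
`K = H - E`, `Kψ = 0`). Koma–Tasaki, J. Stat. Phys. 76 (1994) 745, proof of Thm 2.2. [folklore] -/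
theorem two_mul_re_form_eq_neg_re {H N T : Matrix n n ℂ} (hH : H.IsHermitian) (hN : N.IsHermitian)
    (hD : N * (H * N - N * H) - (H * N - N * H) * N = -T) {E : ℝ} {ψ : n → ℂ}
    (hψ : H *ᵥ ψ = (E : ℂ) • ψ) :
    2 * ((star (N *ᵥ ψ) ⬝ᵥ (H *ᵥ (N *ᵥ ψ))).re - E * (star (N *ᵥ ψ) ⬝ᵥ (N *ᵥ ψ)).re) =
      -(star ψ ⬝ᵥ (T *ᵥ ψ)).re := by
  set K : Matrix n n ℂ := H - (E : ℂ) • (1 : Matrix n n ℂ) with hKdef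
  have hK : K.IsHermitian := by
    change Kᴴ = K
    rw [hKdef, conjTranspose_sub, conjTranspose_smul, conjTranspose_one, hH.eq, Complex.star_def,
      Complex.conj_ofReal]
  have hKψ : K *ᵥ ψ = 0 := by
    rw [hKdef, sub_mulVec, smul_mulVec, one_mulVec, hψ, sub_self]
  have hKv : ∀ v : n → ℂ, K *ᵥ v = H *ᵥ v - (E : ℂ) • v := by
    intro v
    rw [hKdef, sub_mulVec, smul_mulVec, one_mulVec]
  have hKN : K * N - N * K = H * N - N * H := by
    rw [hKdef, Matrix.sub_mul, Matrix.mul_sub, Matrix.smul_mul, Matrix.mul_smul, Matrix.one_mul,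
      Matrix.mul_one]
    abel
  have htian := tian_double_commutator_expectation (X := N) hK hKψ
  rw [hN.eq, hKN, hD, neg_mulVec, dotProduct_neg, hKv, dotProduct_sub, dotProduct_smul, smul_eq_mul] at htian
  have h2 := congrArg Complex.re htian
  rw [Complex.neg_re, Complex.add_re, Complex.sub_re, Complex.re_ofReal_mul] at h2
  linarith

end FSum

/-! ### The torus of even side -/

section Torus

/-- **Registered stub `stub_sublatticeFSumIdentity`** of crux `NoOnsiteODLRO` (stmt-HubbardSuperconductivity-0933;
crux-strategist by-product, not a piece of a line composition): on the torus `(ℤ/Lℤ)²` of even side, the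
double commutator of `hubbardTorus 2 L t U` with the particle number of the even sublattice
`A = {torusStagger = 1}` is minus the hopping operator `hubbardTorus 2 L t 0` (the `f`-sum operator identity
behind the pseudospin ceiling). Zhang, PRL 65 (1990) 120; Koma–Tasaki, J. Stat. Phys. 76 (1994) 745.
[folklore] -/
theorem stub_sublatticeFSumIdentity :
    ∀ (L : ℕ), Even L → ∀ (t U : ℝ),
      Matrix.diagonal (fun s : Finset (Orb (FermionTorus 2 L)) =>
            (((s ∩ orbs (Finset.univ.filter fun x : FermionTorus 2 L => torusStagger x = 1)).card : ℕ) : ℂ)) *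
            (hubbardTorus 2 L t U * Matrix.diagonal (fun s : Finset (Orb (FermionTorus 2 L)) =>
                (((s ∩ orbs (Finset.univ.filter fun x : FermionTorus 2 L => torusStagger x = 1)).card : ℕ) : ℂ)) -
              Matrix.diagonal (fun s : Finset (Orb (FermionTorus 2 L)) =>
                (((s ∩ orbs (Finset.univ.filter fun x : FermionTorus 2 L => torusStagger x = 1)).card : ℕ) : ℂ)) *
                hubbardTorus 2 L t U) -
          (hubbardTorus 2 L t U * Matrix.diagonal (fun s : Finset (Orb (FermionTorus 2 L)) =>
                (((s ∩ orbs (Finset.univ.filter fun x : FermionTorus 2 L => torusStagger x = 1)).card : ℕ) : ℂ)) -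
              Matrix.diagonal (fun s : Finset (Orb (FermionTorus 2 L)) =>
                (((s ∩ orbs (Finset.univ.filter fun x : FermionTorus 2 L => torusStagger x = 1)).card : ℕ) : ℂ)) *
                hubbardTorus 2 L t U) *
            Matrix.diagonal (fun s : Finset (Orb (FermionTorus 2 L)) =>
              (((s ∩ orbs (Finset.univ.filter fun x : FermionTorus 2 L => torusStagger x = 1)).card : ℕ) : ℂ)) =
        -hubbardTorus 2 L t 0 :=
  fun L hL t U => doubleComm_numberDiag_sublattice_hamiltonian (fermionTorusGraph 2 L) torusStagger
    (fun _ _ h => torusStagger_eq_neg_of_adj_holds hL h) t U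

end Torus

end Summit.HubbardSuperconductivity.HubbardSuperconductivity.Theorems.NoOnsiteODLRO.Pseudospin

end
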